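import Mathlib

/-!
# Crux `ChiralMobilityGap` (stmt-QuantumFields-17497), line `Sketch`, stub E `stub_acrossK`

The across-`k` witness bookkeeping for `N_f = 3` (pure real analysis).  In the line's `N_f = 3`
lemma the chiral pin is witnessed across `k` at Euclidean time `n = L_k` on the torus of side
`2L_k + 1`: the available lower bound is `K e^{-(r a_k L_k + p log(L_k+1))}` and it must dominate
`e^{-μ a_k L_k}` for some `μ > r`.  This holds once the physical side `x_k := a_k L_k → ∞` beats the
logarithm of the lattice side, `x_k / log(L_k+2) → ∞`: after taking logarithms the claim is
`p log(L_k+1) - log K ≤ (μ - r) x_k`, and both `p log(L_k+1) ≤ (|p|+1) log(L_k+2)` and `-log K`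
are eventually at most `((μ - r)/2) x_k`.
-/

noncomputable section

namespace Summit.QuantumFields.QCD.Theorems.ChiralMobilityGapSketch

open Filter Topology

/-- STUB E (analysis, `N_f = 3` witness across `k`). If `a_k L_k → ∞` and `a_k L_k / log(L_k+2) → ∞` then
for `r < μ`, any `p` and any `K > 0`, eventually `e^{-μ a_k L_k} ≤ K e^{-(r a_k L_k + p log(L_k+1))}`:
taking logarithms, `p log(L_k+1) - log K ≤ (μ - r) a_k L_k` eventually, since
`p log(L_k+1) ≤ (|p|+1) log(L_k+2) ≤ ((μ-r)/2) a_k L_k` and `-log K ≤ ((μ-r)/2) a_k L_k` eventually. -/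
theorem stub_acrossK :
    ∀ (a : ℕ → ℝ) (L : ℕ → ℕ), (∀ k, 0 < a k) → Tendsto (fun k => a k * L k) atTop atTop →
      Tendsto (fun k => a k * L k / Real.log ((L k : ℝ) + 2)) atTop atTop →
        ∀ {μ r p K : ℝ}, r < μ → 0 < K →
          ∀ᶠ k in atTop, Real.exp (-(μ * (a k * L k))) ≤
            K * Real.exp (-(r * (a k * L k) + p * Real.log ((L k : ℝ) + 1))) := by
  intro a L _ha hx hxlog μ r p K hrμ hK
  have hδ : 0 < (μ - r) / 2 := half_pos (sub_pos.2 hrμ)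
  -- eventually `-log K ≤ ((μ - r)/2) x_k`, from `x_k → ∞`
  have hC : ∀ᶠ k in atTop, -Real.log K ≤ a k * L k * ((μ - r) / 2) := by
    filter_upwards [hx.eventually_ge_atTop (-Real.log K / ((μ - r) / 2))] with k hk
    rwa [div_le_iff₀ hδ] at hk
  -- eventually `(|p| + 1) log(L_k + 2) ≤ ((μ - r)/2) x_k`, from `x_k / log(L_k + 2) → ∞`
  have hB : ∀ᶠ k in atTop, (|p| + 1) * Real.log ((L k : ℝ) + 2) ≤ a k * L k * ((μ - r) / 2) := by
    filter_upwards [hxlog.eventually_ge_atTop ((|p| + 1) / ((μ - r) / 2))] with k hk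
    have hlog : 0 < Real.log ((L k : ℝ) + 2) :=
      Real.log_pos (by have := Nat.cast_nonneg (α := ℝ) (L k); linarith)
    rwa [le_div_iff₀ hlog, div_mul_eq_mul_div, div_le_iff₀ hδ] at hk
  filter_upwards [hB, hC] with k hB hC
  rw [← Real.exp_log hK, ← Real.exp_add, Real.exp_le_exp]
  have hL : (0 : ℝ) ≤ L k := Nat.cast_nonneg (L k)
  have hlog1 : 0 ≤ Real.log ((L k : ℝ) + 1) := Real.log_nonneg (by linarith)
  have hlog12 : Real.log ((L k : ℝ) + 1) ≤ Real.log ((L k : ℝ) + 2) :=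
    Real.log_le_log (by linarith) (by linarith)
  -- `p log(L+1) ≤ |p| log(L+2)`
  have hA : p * Real.log ((L k : ℝ) + 1) ≤ |p| * Real.log ((L k : ℝ) + 2) :=
    (mul_le_mul_of_nonneg_right (le_abs_self p) hlog1).trans
      (mul_le_mul_of_nonneg_left hlog12 (abs_nonneg p))
  have hlog2 : 0 ≤ Real.log ((L k : ℝ) + 2) := hlog1.trans hlog12
  linarith

end Summit.QuantumFields.QCD.Theorems.ChiralMobilityGapSketch

end
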